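import Summits.QuantumFields.YangMills.Theorems.BalabanUVNodesN15KingModelReflectionPositivity
import Summits.QuantumFields.YangMills.Theorems.BalabanUVNodesN15KingModelAxisTransferContraction
import Summits.QuantumFields.YangMills.Theorems.BalabanUVNodesN15KingModelTwoPointInfiniteVolumeSymmetry

/-!
# BalabanUVNodes ∕ N15 — THE KING-MODEL RUNG (PART Ϸ-r): DECAY AT THE RATE `m` ITSELF IN EVERY DIRECTION — `|S₂^{ℝ}(z)| ≤ S₂^{ℝ}(e_ν)e^{m}·e^{−m|z_ν|}` for every
# `z ∈ ℤ^{d+1}` with `|z_ν| ≥ 1`, from REFLECTION POSITIVITY (two sites, Cauchy–Schwarz) + the axial transfer contraction (Track A, DAG node N15 = NE2; FAN-OUT v1.1 §N15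
# s3 «KING-MODEL RUNG»; upgrades part Ϸ-c's «every `c < m`» to `c = m` off the axes too; count-neutral)

HONEST FRAMING.  Count-neutral (cell `pub-ymgap`, seat `pub-ymgap-dag-n15-e` g34; `--supports stmt-QuantumFields-27366 --as helper` = K3⁸
`SpineGivenEndpointR13SepCoPHV`).  King's `A = 0`, `g = 0` model ([King1986] C. King, Commun. Math. Phys. **102** (1986) 649–677; `S₂^{ℝ}` = the infinite-volume
two-point function of the unit-block averages of the continuum free field of mass `m = √m²`, (4.5) p.670, (4.36) p.674, Thm 3.3 (3.6) p.655).  Part Ϸ-k proved the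
reflection positivity `Σc_i c_j S₂^{ℝ}(θ_ν z_i − z_j) ≥ 0` on the half-lattice; with TWO sites `z₁ = (z_⊥, 0)`, `z₂ = (0_⊥, k)` (`k = |z_ν| − 1 ≥ 0`) the four reflected
separations are `θz₁ − z₁ = −e_ν`, `θz₂ − z₂ = −(2k+1)e_ν`, `θz₁ − z₂ = (z_⊥, −(k+1))`, `θz₂ − z₁ = −(z_⊥, k+1)`, whose `S₂^{ℝ}`-values are `S₂^{ℝ}(e_ν)`,
`S₂^{ℝ}((2k+1)e_ν)` and (twice, by part Ϝ-m's evenness and coordinate-reflection invariance) `S₂^{ℝ}(z)`; the `2×2` positivity is the CAUCHY–SCHWARZ inequality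
`S₂^{ℝ}(z)² ≤ S₂^{ℝ}(e_ν)·S₂^{ℝ}((2k+1)e_ν)`, and part Ϸ-m's iterated contraction `S₂^{ℝ}((2k+1)e_ν) ≤ e^{−2mk}S₂^{ℝ}(e_ν)` gives
`|S₂^{ℝ}(z)| ≤ S₂^{ℝ}(e_ν)e^{−mk} = S₂^{ℝ}(e_ν)e^{m}·e^{−m|z_ν|}` — exponential clustering AT THE MASS RATE in every lattice direction, uniformly in `z_⊥`, with the
explicit prefactor `S₂^{ℝ}(e_ν)e^{m}` (part Ϸ-c had every `c < m` with a `c`-dependent constant).  NOT a node discharge (N15 is booked through n15-a's knit, untouched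
here); nothing Bałaban ∕ continuum-Yang–Mills ∕ `ℝ⁴` ∕ OS ∕ Clay.  0 `sorry`, 0 def; standard axioms.

WHAT THIS FILE PROVES (kernel).  `sq_le_mul_of_quadratic_nonneg` (2×2 PSD ⇒ Cauchy–Schwarz), `kingS2Inf_rp_two_sites` (part Ϸ-k with two sites), the four separation
identities `reflect_update_zero_sub_self`, `reflect_single_sub_self`, `reflect_update_zero_sub_single`, `reflect_single_sub_update_zero`, `single_neg_int`, `kingS2Inf_update_neg_natAbs`,
`kingS2Inf_update_natAbs` (the off-diagonal values are `S₂^{ℝ}(z)`), ★★ **`kingS2Inf_sq_le_mul_axis`** (`S₂^{ℝ}(z)² ≤ S₂^{ℝ}(e_ν)S₂^{ℝ}((2k+1)e_ν)`), ★★★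
**`abs_kingS2Inf_le_exp_mass`** (`|S₂^{ℝ}(z)| ≤ S₂^{ℝ}(e_ν)e^{√m²}e^{−√m²|z_ν|}`, `|z_ν| ≥ 1`).

HONEST SCOPE.  King's free model, `K = ∞`, infinite volume; `|z_ν| ≥ 1`.  N15 untouched; counts unmoved.  Locators (use): [King1986] (4.5) p.670, (4.36) p.674, Thm 3.3
(3.6) p.655, Thm 2.1 (2.22)–(2.23) p.654.
-/

noncomputable section

open scoped BigOperators Topology
open Filter MeasureTheory Set

namespace Summit.QuantumFields.YangMills.BalabanUVNodes.N15KingModelRung.OptimalDecay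

variable {d : ℕ}

/-! ## §1 Two-site reflection positivity and Cauchy–Schwarz -/

/-- A nonnegative binary quadratic form with `a₁ > 0` has `b² ≤ a₁a₂` (take `c = (−b, a₁)`). [folklore] -/
theorem sq_le_mul_of_quadratic_nonneg {a₁ a₂ b : ℝ} (ha : 0 < a₁)
    (h : ∀ c₁ c₂ : ℝ, 0 ≤ c₁ * c₁ * a₁ + c₁ * c₂ * b + (c₂ * c₁ * b + c₂ * c₂ * a₂)) : b ^ 2 ≤ a₁ * a₂ := by
  have h1 := h (-b) a₁
  nlinarith

/-- Part Ϸ-k with two sites: for `(z₁)_ν, (z₂)_ν ≥ 0` and all `c₁, c₂`,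
`0 ≤ c₁²S(θz₁−z₁) + c₁c₂S(θz₁−z₂) + c₂c₁S(θz₂−z₁) + c₂²S(θz₂−z₂)`. [cite: King1986, Thm 2.1 (2.22)–(2.23) p.654] -/
theorem kingS2Inf_rp_two_sites {m2 : ℝ} (hm : 0 < m2) (ν : Fin (d + 1)) (z₁ z₂ : Fin (d + 1) → ℤ) (h1 : 0 ≤ z₁ ν) (h2 : 0 ≤ z₂ ν) (c₁ c₂ : ℝ) :
    0 ≤ c₁ * c₁ * kingS2Inf m2 (Function.update z₁ ν (-(z₁ ν) - 1) - z₁) + c₁ * c₂ * kingS2Inf m2 (Function.update z₁ ν (-(z₁ ν) - 1) - z₂)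
      + (c₂ * c₁ * kingS2Inf m2 (Function.update z₂ ν (-(z₂ ν) - 1) - z₁) + c₂ * c₂ * kingS2Inf m2 (Function.update z₂ ν (-(z₂ ν) - 1) - z₂)) := by
  have h := kingS2Inf_reflection_positive hm ν (Finset.univ : Finset (Fin 2)) ![c₁, c₂] ![z₁, z₂] (by
    intro i _
    fin_cases i
    · simpa using h1
    · simpa using h2)
  simpa [Fin.sum_univ_two] using h

/-! ## §2 The four reflected separations for `z₁ = (z_⊥, 0)`, `z₂ = (0_⊥, k)` -/

/-- `θz₁ − z₁ = −e_ν` for `z₁ = (z_⊥, 0)`. [folklore] -/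
theorem reflect_update_zero_sub_self (ν : Fin (d + 1)) (z : Fin (d + 1) → ℤ) :
    Function.update (Function.update z ν 0) ν (-(Function.update z ν 0 ν) - 1) - Function.update z ν 0 = Pi.single ν (-1) := by
  ext μ
  by_cases h : μ = ν
  · subst h; simp
  · simp [h]

/-- `θz₂ − z₂ = −(2k+1)e_ν` for `z₂ = ke_ν`. [folklore] -/
theorem reflect_single_sub_self (ν : Fin (d + 1)) (k : ℤ) :
    Function.update (Pi.single ν k : Fin (d + 1) → ℤ) ν (-((Pi.single ν k : Fin (d + 1) → ℤ) ν) - 1) - Pi.single ν k = Pi.single ν (-(2 * k + 1)) := by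
  ext μ
  by_cases h : μ = ν
  · subst h; simp; ring
  · simp [h]

/-- `θz₁ − z₂ = (z_⊥, −(k+1))`. [folklore] -/
theorem reflect_update_zero_sub_single (ν : Fin (d + 1)) (z : Fin (d + 1) → ℤ) (k : ℤ) :
    Function.update (Function.update z ν 0) ν (-(Function.update z ν 0 ν) - 1) - (Pi.single ν k : Fin (d + 1) → ℤ) = Function.update z ν (-(k + 1)) := by
  ext μ
  by_cases h : μ = ν
  · subst h; simp; ring
  · simp [h]

/-- `θz₂ − z₁ = −(z_⊥, k+1)`. [folklore] -/
theorem reflect_single_sub_update_zero (ν : Fin (d + 1)) (z : Fin (d + 1) → ℤ) (k : ℤ) :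
    Function.update (Pi.single ν k : Fin (d + 1) → ℤ) ν (-((Pi.single ν k : Fin (d + 1) → ℤ) ν) - 1) - Function.update z ν 0 = -Function.update z ν (k + 1) := by
  ext μ
  by_cases h : μ = ν
  · subst h; simp; ring
  · simp [h]

/-- `−x·e_ν = −(x·e_ν)` on `ℤ^{d+1}`. [folklore] -/
theorem single_neg_int (ν : Fin (d + 1)) (x : ℤ) : (Pi.single ν (-x) : Fin (d + 1) → ℤ) = -(Pi.single ν x : Fin (d + 1) → ℤ) := by
  ext μ
  by_cases h : μ = ν
  · subst h; simp
  · simp [h]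

/-- `S₂^{ℝ}((z_⊥, −|z_ν|)) = S₂^{ℝ}(z)` (identity or the `ν`-reflection of part Ϝ-m). [cite: King1986, Thm 2.1 (2.22) p.654] -/
theorem kingS2Inf_update_neg_natAbs (m2 : ℝ) (ν : Fin (d + 1)) (z : Fin (d + 1) → ℤ) :
    kingS2Inf m2 (Function.update z ν (-((z ν).natAbs : ℤ))) = kingS2Inf m2 z := by
  rcases Int.natAbs_eq (z ν) with h | h
  · -- `z_ν = |z_ν|`: the update is the `ν`-reflection
    have e : Function.update z ν (-((z ν).natAbs : ℤ)) = latReflIdx ν z := by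
      ext μ
      by_cases hμ : μ = ν
      · subst hμ; simp [latReflIdx, ← h]
      · simp [latReflIdx, hμ]
    rw [e, kingS2Inf_refl]
  · -- `z_ν = −|z_ν|`: the update is the identity
    have e : Function.update z ν (-((z ν).natAbs : ℤ)) = z := by
      rw [← h]
      exact Function.update_eq_self ν z
    rw [e]

/-- `S₂^{ℝ}((z_⊥, |z_ν|)) = S₂^{ℝ}(z)`. [cite: King1986, Thm 2.1 (2.22) p.654] -/
theorem kingS2Inf_update_natAbs (m2 : ℝ) (ν : Fin (d + 1)) (z : Fin (d + 1) → ℤ) :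
    kingS2Inf m2 (Function.update z ν ((z ν).natAbs : ℤ)) = kingS2Inf m2 z := by
  rcases Int.natAbs_eq (z ν) with h | h
  · have e : Function.update z ν ((z ν).natAbs : ℤ) = z := by
      rw [← h]
      exact Function.update_eq_self ν z
    rw [e]
  · have e : Function.update z ν ((z ν).natAbs : ℤ) = latReflIdx ν z := by
      ext μ
      by_cases hμ : μ = ν
      · subst hμ
        simp only [Function.update_self, latReflIdx, if_true]
        omega
      · simp [latReflIdx, hμ]
    rw [e, kingS2Inf_refl]

/-! ## §3 Cauchy–Schwarz against the axis, and the decay at the mass rate -/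

/-- ★★ **CAUCHY–SCHWARZ AGAINST THE AXIS**: for `|z_ν| = k + 1` (`k ≥ 0`), `S₂^{ℝ}(z)² ≤ S₂^{ℝ}(e_ν)·S₂^{ℝ}((2k+1)e_ν)`. [cite: King1986, Thm 2.1 (2.22)–(2.23) p.654] -/
theorem kingS2Inf_sq_le_mul_axis {m2 : ℝ} (hm : 0 < m2) (ν : Fin (d + 1)) (z : Fin (d + 1) → ℤ) {k : ℕ} (hk : (z ν).natAbs = k + 1) :
    kingS2Inf m2 z ^ 2 ≤ kingS2Inf m2 (Pi.single ν ((1 : ℕ) : ℤ)) * kingS2Inf m2 (Pi.single ν (((2 * k + 1 : ℕ)) : ℤ)) := by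
  have ha : 0 < kingS2Inf m2 (Pi.single ν ((1 : ℕ) : ℤ)) := kingS2Inf_single_pos hm ν (one_le_abs_natCast le_rfl)
  refine sq_le_mul_of_quadratic_nonneg ha fun c₁ c₂ => ?_
  have h := kingS2Inf_rp_two_sites hm ν (Function.update z ν 0) (Pi.single ν (k : ℤ)) (by simp) (by simp) c₁ c₂
  rw [reflect_update_zero_sub_self, reflect_single_sub_self, reflect_update_zero_sub_single, reflect_single_sub_update_zero, kingS2Inf_neg,
    single_neg_int ν (1 : ℤ), single_neg_int ν (2 * (k : ℤ) + 1), kingS2Inf_neg, kingS2Inf_neg] at h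
  have e1 : Function.update z ν (-((k : ℤ) + 1)) = Function.update z ν (-((z ν).natAbs : ℤ)) := by rw [hk]; push_cast; ring_nf
  have e2 : Function.update z ν ((k : ℤ) + 1) = Function.update z ν ((z ν).natAbs : ℤ) := by rw [hk]; push_cast; ring_nf
  rw [e1, e2, kingS2Inf_update_neg_natAbs, kingS2Inf_update_natAbs] at h
  have e3 : (Pi.single ν (2 * (k : ℤ) + 1) : Fin (d + 1) → ℤ) = Pi.single ν (((2 * k + 1 : ℕ)) : ℤ) := by push_cast; ring_nf
  have e4 : (Pi.single ν (1 : ℤ) : Fin (d + 1) → ℤ) = Pi.single ν ((1 : ℕ) : ℤ) := by push_cast; rfl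
  rw [e3, e4] at h
  exact h

/-- ★★★ **DECAY AT THE RATE `m` ITSELF IN EVERY DIRECTION**: for `m² > 0`, every `z ∈ ℤ^{d+1}` and every `ν` with `|z_ν| ≥ 1`,
`|S₂^{ℝ}(z)| ≤ S₂^{ℝ}(e_ν)·e^{√m²}·e^{−√m²|z_ν|}` — reflection positivity (Cauchy–Schwarz against the axis) + the axial contraction; uniform in `z_⊥`.
[cite: King1986, Thm 3.3 (3.6) p.655, Thm 2.1 (2.22)–(2.23) p.654] -/
theorem abs_kingS2Inf_le_exp_mass {m2 : ℝ} (hm : 0 < m2) (z : Fin (d + 1) → ℤ) (ν : Fin (d + 1)) (hz : 1 ≤ (z ν).natAbs) :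
    |kingS2Inf m2 z| ≤ kingS2Inf m2 (Pi.single ν 1) * Real.exp (Real.sqrt m2) * Real.exp (-(Real.sqrt m2 * |(z ν : ℝ)|)) := by
  obtain ⟨k, hk⟩ : ∃ k : ℕ, (z ν).natAbs = k + 1 := ⟨(z ν).natAbs - 1, by omega⟩
  set S1 := kingS2Inf m2 (Pi.single ν ((1 : ℕ) : ℤ)) with hS1
  have hS1pos : 0 < S1 := kingS2Inf_single_pos hm ν (one_le_abs_natCast le_rfl)
  -- `S(2k+1) ≤ e^{−2mk} S(1)`
  have hcontr := kingS2Inf_single_le_exp_mul hm ν (t := 2 * k + 1) (by omega)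
  have hrate : Real.exp (-(Real.sqrt m2 * (((2 * k + 1 : ℕ) : ℝ) - 1))) = Real.exp (-(Real.sqrt m2 * k)) ^ 2 := by
    rw [← Real.exp_nat_mul]
    congr 1
    push_cast
    ring
  rw [hrate] at hcontr
  -- Cauchy–Schwarz: `S(z)² ≤ S1 · S(2k+1) ≤ (S1 e^{−mk})²`
  have hcs := kingS2Inf_sq_le_mul_axis hm ν z hk
  have hsq : kingS2Inf m2 z ^ 2 ≤ (S1 * Real.exp (-(Real.sqrt m2 * k))) ^ 2 := by
    calc kingS2Inf m2 z ^ 2 ≤ S1 * kingS2Inf m2 (Pi.single ν (((2 * k + 1 : ℕ)) : ℤ)) := hcs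
      _ ≤ S1 * (Real.exp (-(Real.sqrt m2 * k)) ^ 2 * S1) := mul_le_mul_of_nonneg_left hcontr hS1pos.le
      _ = (S1 * Real.exp (-(Real.sqrt m2 * k))) ^ 2 := by ring
  have habs : |kingS2Inf m2 z| ≤ S1 * Real.exp (-(Real.sqrt m2 * k)) := abs_le.mpr (abs_le_of_sq_le_sq' hsq (by positivity))
  -- `e^{−mk} = e^{m} e^{−m|z_ν|}`, `|z_ν| = k + 1`
  have hzabs : |(z ν : ℝ)| = (k : ℝ) + 1 := by
    rw [← Int.cast_abs, Int.abs_eq_natAbs, hk]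
    push_cast
    ring
  have hS1' : kingS2Inf m2 (Pi.single ν 1) = S1 := by rw [hS1]; push_cast; rfl
  rw [hS1', hzabs, mul_assoc, ← Real.exp_add, show Real.sqrt m2 + -(Real.sqrt m2 * ((k : ℝ) + 1)) = -(Real.sqrt m2 * k) by ring]
  exact habs

end Summit.QuantumFields.YangMills.BalabanUVNodes.N15KingModelRung.OptimalDecay
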